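import Mathlib.Order.ConditionallyCompleteLattice.Finset
import Mathlib.LinearAlgebra.Dimension.Finrank
import Literature.Topology.FourManifolds.LeeRasmussen
import Literature.Topology.FourManifolds.KhResolutionsCircleProofs
import Literature.Topology.FourManifolds.KhComplexQDegreeProofs
import Literature.Topology.FourManifolds.KhResolutionsDichotomyProofs
import Literature.Topology.FourManifolds.LeeRasmussenRankProofs
import Literature.Topology.FourManifolds.RegularProjectionParity
import HarnessLib

/-!
# Parity of Rasmussen's `s`: the lattice bookkeeping (towards `even_rasmussenInvariant`)

Sibling proof file of `LeeRasmussen.lean` for the named fact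
`Literature.Topology.FourManifolds.GaussDiagram.even_rasmussenInvariant` (Rasmussen (2010),
Prop. 3.3 and Thm. 1: the invariant `s` of a knot is an even integer).

Rasmussen's argument (2010, §2.1 and proof of Prop. 3.3): every generator of the Khovanov/Lee
complex of a *knot* diagram has odd quantum grading (all `q`-gradings of `CKh(K)` are congruent
to `1` modulo `2` for a knot, `Kh(K)` being supported in odd `q`-degrees), so the filtration
degree `s(x)` of every nonzero chain, hence `s_min`, `s_max`, is odd and `s = s_max - 1` is even.
In the enhanced-state model of `KhComplex`/`LeeRasmussen` this splits into three steps: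

1. (this file, proved) **lattice bookkeeping**: if Lee homology in degree `0` of the diagram `G`
   is nontrivial and every enhanced state of homological degree `0` has odd quantum degree, then
   `G.rasmussenInvariant` is even (`even_rasmussenInvariant_of_odd_qDegree`): the suprema and
   infima defining `qMin`, `classDegree`, `leeSMax` range over finite sets of values
   `qDegree s`, so `leeSMax = qDegree s₀` for some degree-`0` enhanced state `s₀`;
2. (planarity) every enhanced state of a *realisable* diagram has odd quantum degree — this
   rests on the merge/split dichotomy `isMergeAt_or_isSplitAt_of_hasGaussDiagram` (named fact of
   `KhResolutions`, Jordan curve theorem) and fails for virtual diagrams;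
3. (Lee's theorem) Lee homology in degree `0` of a knot diagram is nontrivial — the named fact
   `finrank_leeHomologyZero_eq_two` of `LeeRasmussen`.

No new named fact is introduced here (D-0026); steps 2–3 are quoted as the existing named facts.

Steps 2 and 3 are carried out *conditionally* in the second half of the file: given the
dichotomy (hypothesis `hP : isMergeAt_or_isSplitAt_of_hasGaussDiagram`), every flip changes the
number of state circles by exactly one (`circleCount_eq_of_isMergeAt`,
`circleCount_eq_of_isSplitAt` of `KhResolutionsCircleProofs`), so `k(σ) + |σ|` has constant
parity (`even_circleCount_add_weight_iff`); the Seifert state has weight `n₋` and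
`k ≡ n + 1 (mod 2)` circles (`even_circleCount_seifertState_add`, valid for every Gauss diagram),
whence `q(s) ≡ k + |σ| + n₊ ≡ (n + 1) + n₋ + n₊ ≡ 1 (mod 2)` (`odd_qDegree`). Together with
Lee's theorem (hypothesis `hL : finrank_leeHomologyZero_eq_two`) this proves the named fact:
`even_rasmussenInvariant_of_facts hP hL : even_rasmussenInvariant`. The unconditional discharge
`even_rasmussenInvariant_holds` is exactly this term once the two named facts are discharged.

Step 4 (reduction to Gauss's parity condition) composes with the sibling files that appeared
since: Lee's theorem in degree `0` follows from the dichotomy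
(`finrank_leeHomologyZero_eq_two_of_dichotomy`, `LeeRasmussenRankProofs`), and the dichotomy for
`G` follows from Gauss's parity condition for `G` — every chord joins marked points of opposite
parity (`isMergeAt_or_isSplitAt_of_overPos_mod_two_ne`, `KhResolutionsDichotomyProofs`). Hence
`even_rasmussenInvariant_of_dichotomy` (the dichotomy alone suffices) and
`even_rasmussenInvariant_of_gaussParity`: **the only input still missing for
`even_rasmussenInvariant_holds` is Gauss's parity theorem for regular projections of knots** (a
closed normal plane curve passes an even number of crossings between its two visits of any
crossing; C. F. Gauss, *Werke* VIII, pp. 272, 282–286).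

Step 5 (discharge): Gauss's parity theorem for regular projections is the tree's
`Knot.RegularProjection.overPos_mod_two_ne_underPos_mod_two` (`RegularProjectionParity`, by winding
numbers), which closes the named fact: `even_rasmussenInvariant_holds`.

## References

* J. Rasmussen, *Khovanov homology and the slice genus*, Invent. Math. 182 (2010) 419–447,
  §2.1 (gradings; `q`-gradings of a knot are odd), Def. 3.1, Prop. 3.3, Def. 3.4, Thm. 1
  (`s(K) ∈ 2ℤ`). [cite: Rasmussen2010, Prop. 3.3]
* E. S. Lee, *An endomorphism of the Khovanov invariant*, Adv. Math. 197 (2005), Thm. 4.2.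
-/

open Function Set

noncomputable section

namespace Literature.Topology.FourManifolds

namespace GaussDiagram

variable {G : GaussDiagram}

/-! ## Step 1: the filtration values are quantum degrees of enhanced states -/

/-- The filtration degree `qMin x` of a *nonzero* degree-zero chain is the quantum degree of
some enhanced state of homological degree `0` (the infimum over the finite nonempty support is
attained). Rasmussen (2010), §2.1 (`s(x)` for chains). [cite: Rasmussen2010, §2.1] -/
theorem qMin_mem_range {x : G.degStates 0 → ℚ} (hx : x ≠ 0) :
    qMin x ∈ Set.range
      (fun s : G.degStates 0 ↦ ((qDegree s.1 : WithTop ℤ) : WithBot (WithTop ℤ))) := by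
  obtain ⟨s₀, hs₀⟩ : ∃ s, x s ≠ 0 := by
    by_contra! h
    exact hx (funext h)
  have h1 : qMin x = sInf ((fun s : G.degStates 0 ↦
      ((qDegree s.1 : WithTop ℤ) : WithBot (WithTop ℤ))) '' {s | x s ≠ 0}) := by
    rw [qMin, sInf_image]
  have hne : ((fun s : G.degStates 0 ↦ ((qDegree s.1 : WithTop ℤ) : WithBot (WithTop ℤ))) ''
      {s | x s ≠ 0}).Nonempty := ⟨_, s₀, hs₀, rfl⟩
  obtain ⟨s, -, hs⟩ := hne.csInf_mem ((Set.toFinite _).image _)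
  exact ⟨s, hs.trans h1.symm⟩

/-- Rasmussen's `s(α)` of a *nonzero* degree-zero Lee homology class is the quantum degree of
some enhanced state of homological degree `0` (the supremum over representing cycles ranges over
a finite set of attained filtration degrees, hence is attained). Rasmussen (2010), §2.2,
Def. 3.1. [cite: Rasmussen2010, Def. 3.1] -/
theorem classDegree_mem_range {α : G.LeeHomologyZero} (hα : α ≠ 0) :
    classDegree α ∈ Set.range
      (fun s : G.degStates 0 ↦ ((qDegree s.1 : WithTop ℤ) : WithBot (WithTop ℤ))) := by
  have h1 : classDegree α = sSup ((fun z : G.leeCycles ↦ qMin z.1) ''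
      {z : G.leeCycles | Submodule.Quotient.mk z = α}) := by
    rw [classDegree, sSup_image]
  have hsub : (fun z : G.leeCycles ↦ qMin z.1) '' {z : G.leeCycles | Submodule.Quotient.mk z = α}
      ⊆ Set.range (fun s : G.degStates 0 ↦
        ((qDegree s.1 : WithTop ℤ) : WithBot (WithTop ℤ))) := by
    rintro _ ⟨z, hz, rfl⟩
    refine qMin_mem_range fun h0 ↦ hα ?_
    have hz0 : z = 0 := Subtype.ext h0
    have hz' : Submodule.Quotient.mk z = α := hz
    rw [← hz', hz0, Submodule.Quotient.mk_zero]
    rfl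
  have hne : ((fun z : G.leeCycles ↦ qMin z.1) ''
      {z : G.leeCycles | Submodule.Quotient.mk z = α}).Nonempty := by
    induction α using Submodule.Quotient.induction_on with
    | H z => exact ⟨_, z, rfl, rfl⟩
  rw [h1]
  exact hsub (hne.csSup_mem ((Set.finite_range _).subset hsub))

/-- If Lee homology in degree `0` is nontrivial, `s_max` of the diagram is the quantum degree of
some enhanced state of homological degree `0` (a supremum over a nonempty finite set of attained
values). Rasmussen (2010), Def. 3.1. [cite: Rasmussen2010, Def. 3.1] -/
theorem leeSMax_mem_range (hnt : Nontrivial G.LeeHomologyZero) :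
    G.leeSMax ∈ Set.range
      (fun s : G.degStates 0 ↦ ((qDegree s.1 : WithTop ℤ) : WithBot (WithTop ℤ))) := by
  have h1 : G.leeSMax = sSup (classDegree '' {α : G.LeeHomologyZero | α ≠ 0}) := by
    rw [leeSMax, sSup_image]
  have hsub : classDegree '' {α : G.LeeHomologyZero | α ≠ 0} ⊆ Set.range
      (fun s : G.degStates 0 ↦ ((qDegree s.1 : WithTop ℤ) : WithBot (WithTop ℤ))) := by
    rintro _ ⟨α, hα, rfl⟩
    exact classDegree_mem_range hα
  obtain ⟨α, hα⟩ := exists_ne (0 : G.LeeHomologyZero)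
  have hne : (classDegree '' {α : G.LeeHomologyZero | α ≠ 0}).Nonempty := ⟨_, α, hα, rfl⟩
  rw [h1]
  exact hsub (hne.csSup_mem ((Set.finite_range _).subset hsub))

/-- **Lattice bookkeeping for the parity of `s`.** If Lee homology of the Gauss diagram `G` in
degree `0` is nontrivial and every enhanced state of homological degree `0` has odd quantum
degree, then Rasmussen's invariant `s(G) = s_max - 1` is even: `s_max` is then one of these odd
quantum degrees (`leeSMax_mem_range`). This is the formal skeleton of Rasmussen (2010),
Prop. 3.3 / Thm. 1 (`s(K)` is even because all `q`-gradings of a knot are odd); the two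
hypotheses are supplied, for realisable diagrams, by Lee's theorem
(`finrank_leeHomologyZero_eq_two`) and by planarity (`isMergeAt_or_isSplitAt_of_hasGaussDiagram`).
[cite: Rasmussen2010, Prop. 3.3] -/
theorem even_rasmussenInvariant_of_odd_qDegree (hnt : Nontrivial G.LeeHomologyZero)
    (hodd : ∀ s : G.degStates 0, Odd (qDegree s.1)) : Even G.rasmussenInvariant := by
  obtain ⟨s, hs⟩ := leeSMax_mem_range hnt
  rw [rasmussenInvariant, ← hs]
  simp only [WithBot.unbotD_coe, WithTop.untopD_coe]
  exact (hodd s).sub_odd odd_one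

/-- Lee's theorem (the named fact `finrank_leeHomologyZero_eq_two`, hypothesis `hL`) makes the
degree-zero Lee homology of a realisable diagram nontrivial. Lee (2005), Thm. 4.2;
Rasmussen (2010), Prop. 2.3. [cite: Lee2005, Thm. 4.2] -/
theorem nontrivial_leeHomologyZero (hL : finrank_leeHomologyZero_eq_two)
    (hG : ∃ K : Knot, K.HasGaussDiagram G) : Nontrivial G.LeeHomologyZero :=
  Module.nontrivial_of_finrank_pos (R := ℚ) (by rw [hL hG]; exact Nat.zero_lt_two)

/-! ## Step 2: all quantum degrees of a realisable diagram are odd (given the dichotomy) -/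

/-- Every state circle of an enhanced state is labelled `1` or `X`, not both: the numbers of
circles labelled `1` and of circles labelled `X` add up to the number of circles.
Viro (2004), §5.1; Bar-Natan (2002), §3.2. [cite: Viro2004, §5.1] -/
theorem card_filter_label_false_add (s : G.EnhancedState) :
    (Finset.univ.filter fun c : G.StateCircle s.state ↦
        ∃ a, G.circleOf s.state a = c ∧ s.label a = false).card +
      (Finset.univ.filter fun c : G.StateCircle s.state ↦
        ∃ a, G.circleOf s.state a = c ∧ s.label a = true).card = G.circleCount s.state := by
  have key : ∀ c : G.StateCircle s.state,
      (∃ a, G.circleOf s.state a = c ∧ s.label a = true) ↔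
        ¬ (∃ a, G.circleOf s.state a = c ∧ s.label a = false) := by
    intro c
    induction c using SimpleGraph.ConnectedComponent.ind with
    | h v =>
    constructor
    · rintro ⟨a, ha, hat⟩ ⟨b, hb, hbf⟩
      have hab : (G.stateGraph s.state).Reachable a b :=
        SimpleGraph.ConnectedComponent.exact (ha.trans hb.symm)
      have h := s.label_eq_of_reachable hab
      rw [hat, hbf] at h
      exact Bool.noConfusion h
    · intro h
      refine ⟨v, rfl, ?_⟩
      cases hv : s.label v
      · exact (h ⟨v, rfl, hv⟩).elim
      · rfl
  rw [circleCount, ← Finset.card_univ, ← Finset.card_filter_add_card_filter_not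
    (s := (Finset.univ : Finset (G.StateCircle s.state)))
    (fun c ↦ ∃ a, G.circleOf s.state a = c ∧ s.label a = false)]
  congr 2
  exact Finset.filter_congr fun c _ ↦ key c

/-- The quantum degree rewritten: `q(s) = (k + |s| + n₊) - 2 (#X-circles + n₋)` where `k` is
the number of circles of the underlying state. Bar-Natan (2002), §3.2. [cite: BarNatan2002, §3.2] -/
theorem qDegree_eq_sub_two_mul (s : G.EnhancedState) :
    qDegree s = ((G.circleCount s.state + s.state.weight + G.nPlus : ℕ) : ℤ) -
      2 * ((Finset.univ.filter fun c : G.StateCircle s.state ↦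
        ∃ a, G.circleOf s.state a = c ∧ s.label a = true).card + G.nMinus : ℕ) := by
  have h : ((G.circleCount s.state : ℕ) : ℤ) =
      ((Finset.univ.filter fun c : G.StateCircle s.state ↦
          ∃ a, G.circleOf s.state a = c ∧ s.label a = false).card : ℤ) +
        ((Finset.univ.filter fun c : G.StateCircle s.state ↦
          ∃ a, G.circleOf s.state a = c ∧ s.label a = true).card : ℤ) := by
    exact_mod_cast (card_filter_label_false_add s).symm
  unfold qDegree
  push_cast
  rw [h]
  ring

/-- **Parity of the quantum degree.** `q(s) ≡ k + |s| + n₊ (mod 2)`, with `k` the number of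
circles of the underlying state. Rasmussen (2010), §2.1; Bar-Natan (2002), §3.2. [cite: Rasmussen2010, §2.1] -/
theorem odd_qDegree_iff (s : G.EnhancedState) :
    Odd (qDegree s) ↔ Odd (G.circleCount s.state + s.state.weight + G.nPlus) := by
  rw [qDegree_eq_sub_two_mul, Int.odd_sub, Int.odd_coe_nat]
  simp

/-- **The parity of `k(σ) + |σ|` is constant for a realisable diagram**, conditional on the
merge/split dichotomy (named fact `isMergeAt_or_isSplitAt_of_hasGaussDiagram`, hypothesis `hP`):
every flip `0 → 1` raises the weight by one and changes the number of circles by exactly one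
(`circleCount_eq_of_isMergeAt`, `circleCount_eq_of_isSplitAt`); induction on the set of
`1`-smoothed chords. Rasmussen (2010), §2.1; Bar-Natan (2002), §3.2. [cite: Rasmussen2010, §2.1] -/
theorem even_circleCount_add_weight_iff (hG : ∃ K : Knot, K.HasGaussDiagram G)
    (hP : isMergeAt_or_isSplitAt_of_hasGaussDiagram (G := G)) (σ : G.State) :
    Even (G.circleCount σ + σ.weight) ↔ Even (G.circleCount fun _ ↦ false) := by
  suffices h : ∀ (S : Finset (Fin G.n)) (σ : G.State),
      (Finset.univ.filter fun j ↦ σ j = true) = S →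
        (Even (G.circleCount σ + σ.weight) ↔ Even (G.circleCount fun _ ↦ false)) from
    h _ σ rfl
  intro S
  induction S using Finset.induction_on with
  | empty =>
    intro σ hσ
    have h0 : σ = fun _ ↦ false := by
      funext j
      have := Finset.filter_eq_empty_iff.1 hσ (Finset.mem_univ j)
      simpa using this
    subst h0
    simp [State.weight]
  | @insert i S hi ih =>
    intro σ hσ
    have hσi : σ i = true := by
      have : i ∈ Finset.univ.filter fun j ↦ σ j = true := by
        rw [hσ]
        exact Finset.mem_insert_self _ _
      simpa using this
    set τ : G.State := Function.update σ i false with hτ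
    have hτσ : Function.update τ i true = σ := by
      rw [hτ, Function.update_idem, Function.update_eq_self_iff, hσi]
    have hτi : τ i = false := by simp [hτ]
    have hτS : (Finset.univ.filter fun j ↦ τ j = true) = S := by
      ext j
      by_cases hj : j = i
      · subst hj
        simp [hτ, hi]
      · have hmem : (j ∈ Finset.univ.filter fun j ↦ σ j = true) ↔ j ∈ insert i S := by
          rw [hσ]
        simp only [Finset.mem_filter, Finset.mem_univ, true_and, Finset.mem_insert, hj,
          false_or] at hmem
        simpa [hτ, Function.update_of_ne hj] using hmem
    have ihτ := ih τ hτS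
    have hw : σ.weight = τ.weight + 1 := by
      rw [← hτσ]
      exact State.weight_update hτi
    rcases hP hG hτi with hm | hs
    · have hc := circleCount_eq_of_isMergeAt hm
      rw [hτσ] at hc
      rw [← ihτ, hw, hc, Nat.even_iff, Nat.even_iff]
      omega
    · have hc := circleCount_eq_of_isSplitAt hs
      rw [hτσ] at hc
      rw [← ihτ, hw, hc, Nat.even_iff, Nat.even_iff]
      omega

/-- **All quantum degrees of a knot diagram are odd** (conditional on the merge/split
dichotomy `isMergeAt_or_isSplitAt_of_hasGaussDiagram`, hypothesis `hP`): `q(s) ≡ k(σ) + |σ| + n₊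
≡ k(σₒ) + n₋ + n₊ ≡ (n + 1) + n ≡ 1 (mod 2)`, where `σₒ` is the Seifert state (weight `n₋`,
`k(σₒ) ≡ n + 1` by `even_circleCount_seifertState_add`). Rasmussen (2010), §2.1 ("all
`q`-gradings of `CKh(K)` are odd for a knot"). [cite: Rasmussen2010, §2.1] -/
theorem odd_qDegree (hG : ∃ K : Knot, K.HasGaussDiagram G)
    (hP : isMergeAt_or_isSplitAt_of_hasGaussDiagram (G := G)) (s : G.EnhancedState) :
    Odd (qDegree s) := by
  rw [odd_qDegree_iff]
  have h1 := even_circleCount_add_weight_iff hG hP s.state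
  have h2 := even_circleCount_add_weight_iff hG hP G.seifertState
  rw [weight_seifertState] at h2
  have h3 := G.even_circleCount_seifertState_add
  have h4 := G.nPlus_add_nMinus
  rw [Nat.even_iff, Nat.even_iff] at h1 h2
  rw [Nat.even_iff] at h3
  rw [Nat.odd_iff]
  omega

/-! ## Step 3: assembly -/

/-- **Rasmussen's `s` is even, conditionally.** The named fact `even_rasmussenInvariant`
(Rasmussen (2010), Prop. 3.3 / Thm. 1: `s(K) ∈ 2ℤ`) follows from the two named facts it rests
on: the merge/split dichotomy for realisable diagrams (`isMergeAt_or_isSplitAt_of_hasGaussDiagram`,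
planarity; hypothesis `hP`) and Lee's theorem in degree zero (`finrank_leeHomologyZero_eq_two`;
hypothesis `hL`). Proof: `s = s_max - 1` with `s_max` an (odd) quantum degree of a degree-zero
enhanced state (`even_rasmussenInvariant_of_odd_qDegree`, `odd_qDegree`).
[cite: Rasmussen2010, Prop. 3.3] -/
theorem even_rasmussenInvariant_of_facts
    (hP : ∀ G : GaussDiagram, isMergeAt_or_isSplitAt_of_hasGaussDiagram (G := G))
    (hL : finrank_leeHomologyZero_eq_two) : even_rasmussenInvariant :=
  fun {G} hG ↦ even_rasmussenInvariant_of_odd_qDegree (nontrivial_leeHomologyZero hL hG)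
    fun s ↦ odd_qDegree hG (hP G) s.1

/-! ## Step 4: reduction to Gauss's parity condition -/

/-- **Rasmussen's `s` is even, given the merge/split dichotomy alone.** Lee's theorem in degree
zero is itself a consequence of the dichotomy (`finrank_leeHomologyZero_eq_two_of_dichotomy`), so
the named fact `even_rasmussenInvariant` (Rasmussen (2010), Prop. 3.3 / Thm. 1) follows from the
single named fact `isMergeAt_or_isSplitAt_of_hasGaussDiagram` (for all diagrams).
[cite: Rasmussen2010, Prop. 3.3] -/
theorem even_rasmussenInvariant_of_dichotomy
    (hP : ∀ G : GaussDiagram, isMergeAt_or_isSplitAt_of_hasGaussDiagram (G := G)) :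
    even_rasmussenInvariant :=
  even_rasmussenInvariant_of_facts hP (finrank_leeHomologyZero_eq_two_of_dichotomy hP)

/-- **Rasmussen's `s` is even, given Gauss's parity condition for realisable diagrams.** If every
chord of every realisable Gauss diagram joins marked points of opposite parity (Gauss's parity
theorem for closed normal plane curves), then `s` is even for every realisable diagram: the parity
condition gives the dichotomy (`isMergeAt_or_isSplitAt_of_overPos_mod_two_ne`).
Rasmussen (2010), Prop. 3.3 / Thm. 1. [cite: Rasmussen2010, Prop. 3.3] -/
theorem even_rasmussenInvariant_of_overPos_mod_two_ne
    (hpar : ∀ G : GaussDiagram, (∃ K : Knot, K.HasGaussDiagram G) →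
      ∀ j : Fin G.n, (G.overPos j).val % 2 ≠ (G.underPos j).val % 2) :
    even_rasmussenInvariant :=
  even_rasmussenInvariant_of_dichotomy fun G _ _ hG hσ ↦
    isMergeAt_or_isSplitAt_of_overPos_mod_two_ne (hpar G hG) hσ

/-- **Rasmussen's `s` is even, given Gauss's parity theorem for regular projections.** If in
every regular projection of every knot the two passages through each crossing occupy positions of
opposite parity along the knot (C. F. Gauss: between the two visits of a crossing a closed normal
plane curve passes an even number of crossings), then `s` is even for every realisable Gauss
diagram. This is the exact remaining input for `even_rasmussenInvariant_holds`.
Rasmussen (2010), Prop. 3.3 / Thm. 1. [cite: Rasmussen2010, Prop. 3.3] -/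
theorem even_rasmussenInvariant_of_gaussParity
    (hpar : ∀ (K : Knot) (P : K.RegularProjection) (j : Fin P.diagram.n),
      (P.diagram.overPos j).val % 2 ≠ (P.diagram.underPos j).val % 2) :
    even_rasmussenInvariant :=
  even_rasmussenInvariant_of_overPos_mod_two_ne fun G hG j ↦ by
    obtain ⟨K, P, rfl⟩ := hG
    exact hpar K P j

/-! ## Step 5: the discharge -/

/-- **Rasmussen's `s` is even** (discharge of the named fact `even_rasmussenInvariant`): for every
Gauss diagram realised by a knot, `G.rasmussenInvariant` is an even integer. Assembled from
Gauss's parity theorem for regular projections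
(`Knot.RegularProjection.overPos_mod_two_ne_underPos_mod_two`, `RegularProjectionParity`), the
merge/split dichotomy it implies (`KhResolutionsDichotomyProofs`), Lee's theorem in degree zero
(`LeeRasmussenRankProofs`) and the oddness of all quantum degrees of a knot diagram (this file).
Rasmussen (2010), Prop. 3.3 and Thm. 1 (`s(K) ∈ 2ℤ`). [cite: Rasmussen2010, Prop. 3.3] -/
theorem even_rasmussenInvariant_holds : even_rasmussenInvariant :=
  even_rasmussenInvariant_of_gaussParity fun _ P j ↦ P.overPos_mod_two_ne_underPos_mod_two j

end GaussDiagram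

end Literature.Topology.FourManifolds
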